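import Literature.Computability.QuantumComplexity.IsometryInvolutionGate
import Literature.Computability.QuantumComplexity.GroverSearch
import HarnessLib

/-!
# The exact `k`-query algorithm for `EXACT_k^{2k}` (Ambainis–Iraids–Smotrovs 2013, Thm. 1) — core:
# histories, amplitudes, the round family and its admissibility

Topic `Computability/QuantumComplexity`. A. Ambainis, J. Iraids, J. Smotrovs, *Exact quantum query
complexity of EXACT and THRESHOLD*, TQC 2013 [AmbainisIraidsSmotrovs2013], §3, Theorem 1 and its proof
(held text `paper:arxiv-1302.1235`, p. 5 L6–47):

> **Theorem 1.** `Q_E(EXACT_k^{2k}) ≤ k`.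
> *Proof.* We present a recursive algorithm. When `k = 0` the algorithm returns `1` without making any
> queries. Suppose `k = m`. For the recursive step we will use basis states `|0⟩, |1⟩, …, |n⟩` and
> `|i,j⟩` with `i, j ∈ [2m]`, `i < j`. […] We begin in the state `|0⟩` and perform a unitary
> transformation `U_1`: `U_1|0⟩ → Σ_{i=1}^{2m} (1/√(2m)) |i⟩`. Next we perform a query:
> `… → Σ_i (x̂_i/√(2m)) |i⟩`. Finally, we perform a unitary transformation `U_2`, such that
> `U_2|i⟩ = Σ_{j>i} (1/√(2m)) |i,j⟩ − Σ_{j<i} (1/√(2m)) |j,i⟩ + (1/√(2m)) |0⟩`. One can verify that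
> such a unitary transformation exists by checking the inner products: […] `= 1` […] `= 0`.
> The resulting quantum state is `Σ_i (x̂_i/2m) |0⟩ + Σ_{i<j} ((x̂_i − x̂_j)/2m) |i,j⟩`. If we measure
> the state and get `|0⟩`, then `EXACT_m^{2m}(x) = 0`. If on the other hand we get `|i,j⟩`, then
> `x_i ≠ x_j` and `EXACT_m^{2m}(x) = EXACT_{m−1}^{2m−2}(x ∖ {x_i, x_j})`, therefore we can use our
> algorithm for `EXACT_{m−1}^{2m−2}`. □ Note that we can delay the measurements by using `|i,j⟩` as a
> starting state for the recursive call of the algorithm.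

This file and `ExactHalfQueryAlgorithm.lean` type that proof as ONE straight-line program in the tree's
query model `QQueryAlg (2k)` ([BealsEtAl2001, §2]: unitaries interleaved with `O_x`, one measurement
at the end), following the printed remark on delayed measurements. The workspace `WS k = Bool × Hist k`
records, for every index, the round in which it was removed (`Hist k`), plus a status bit (`parked` =
"some call measured `|0⟩`"). The printed proof and its image here:

* the call's basis states `|1⟩, …, |2m⟩` ↦ the live states `|l, b, live, g⟩`, `l` free in the history `g`
  (`Dset`); the call's `|0⟩` ↦ the parked state `|i0, b, parked, g⟩` (`deadIdx`); the call's `|i,j⟩`, "a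
  starting state for the recursive call" ↦ the next call's prepared state
  `ψ_{g·{i,j}} = (1/√(2m−2)) Σ_{l free} |l, b, live, g·{i,j}⟩` (`campl`, `psiR`; in the last round the
  call `EXACT⁰₀` "returns `1` without making any queries": `ψ` is then the accepted basis state
  `|i0, b, live, g⟩`);
* the query `|i⟩ ↦ x̂_i |i⟩` ↦ the model's `O_x` with the target qubit `b` in `|−⟩` (`xhat`; the
  phase-query convention of [BealsEtAl2001, §2]);
* `U_2` ↦ the round family `w(|i, b, live, h⟩) = (1/√(2m)) (|i0, b, parked, h⟩ + Σ_{j ≠ i} sign(i,j)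
  ψ_{h·{i,j}, b})` (`wR` / `wvec`; `pairSignR i j` is the printed `+` for `j > i` and `−` for `j < i`);
  the printed inner-product check is `wR_dot_self` (`= 1`) and `wR_dot_of_ne` (`= 0`), packaged as
  `wvec_isAdmissible`; the unitary with these columns ("such a unitary transformation exists") is
  `IsoGate.invoGate` of `IsometryInvolutionGate.lean`, applied in `ExactHalfQueryAlgorithm.lean`;
* "the resulting quantum state" ↦ the amplitude `beta` of a history, `β(h·{a,b}) = β(h) · (±(x̂_a − x̂_b))
  / (2m)` (`pairSum`, `pairSum_pair`), and the re-indexing of the branching over ordered pairs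
  (`sum_validSet_offDiag_free`);
* "if we get `|0⟩`, then `EXACT(x) = 0`" and "then `x_i ≠ x_j`" ↦ the counting lemmas: surviving
  histories have all pairs mixed (`onesIn_labelSet_of_beta_ne_zero`, via `pairSum_ne_zero_iff`), a full
  surviving history forces `|x| = k` (`hw_eq_of_beta_ne_zero`), and on balanced inputs the
  `|0⟩`-amplitude `Σ_{free} x̂_i / (2m)` of every call vanishes (`sum_xhat_free_eq_zero`).

Deviation from the printed text, forced by the model: the recursion is unrolled into `k` rounds on one
register (histories instead of a call stack), and the normalisation `1/√(2m)` is written `1/√(#free h)`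
(`cw`; equal on valid histories, `card_free_add`). The program, the invariant and Theorem 1 itself
(`quantumQueryComplexity 0 [ |x| = k ] = k` on `Fin (2k)`, the floor being [AIS13, Prop. 2] =
`ExactThreshold.le_quantumQueryComplexity_zero_exactWeight`) are in `ExactHalfQueryAlgorithm.lean`.
Everything in this file is proved; no instance, notation or axiom is introduced.

* [AmbainisIraidsSmotrovs2013] A. Ambainis, J. Iraids, J. Smotrovs, *Exact quantum query complexity of
  EXACT and THRESHOLD*, Proc. TQC 2013 (LIPIcs 22) 263–269; arXiv:1302.1235 — §3, Thm. 1 and its proof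
  (p. 5 L6–47).
* [BealsEtAl2001] R. Beals, H. Buhrman, R. Cleve, M. Mosca, R. de Wolf, *Quantum lower bounds by
  polynomials*, J. ACM 48(4) (2001) 778–797 — §2 (the query model `U_T O_x ⋯ O_x U_0`, phase queries).
-/

noncomputable section

open Finset

namespace Literature.Computability.QuantumComplexity.ExactHalf

variable {k : ℕ}

/-! ### Histories: which round removed each index -/

/-- A history: for each of the `2k` indices, the round (`< k`) in which it was removed, if any.
[cite: AmbainisIraidsSmotrovs2013, §3 (proof of Thm. 1: "using `|i,j⟩` as a starting state for the recursive call")] -/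
abbrev Hist (k : ℕ) := Fin (2 * k) → Option (Fin k)

/-- The indices removed in round `r`. [cite: AmbainisIraidsSmotrovs2013, §3] -/
def labelSet (h : Hist k) (r : Fin k) : Finset (Fin (2 * k)) := univ.filter fun i => h i = some r

/-- The indices still active. [cite: AmbainisIraidsSmotrovs2013, §3] -/
def free (h : Hist k) : Finset (Fin (2 * k)) := univ.filter fun i => h i = none

/-- A valid history after `t` rounds: only rounds `< t` occur, each removing exactly two indices.
[cite: AmbainisIraidsSmotrovs2013, §3] -/
def Valid (t : ℕ) (h : Hist k) : Prop :=
  (∀ i r, h i = some r → r.val < t) ∧ (∀ r : Fin k, r.val < t → (labelSet h r).card = 2)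

/-- The empty history. [cite: AmbainisIraidsSmotrovs2013, §3] -/
def emptyHist (k : ℕ) : Hist k := fun _ => none

/-- Removing the pair `{i, j}` in round `t`. [cite: AmbainisIraidsSmotrovs2013, §3] -/
def addPair (h : Hist k) (t : Fin k) (i j : Fin (2 * k)) : Hist k :=
  fun l => if l = i ∨ l = j then some t else h l

/-- Undoing round `t`. [cite: AmbainisIraidsSmotrovs2013, §3] -/
def eraseRound (h : Hist k) (t : Fin k) : Hist k := fun l => if h l = some t then none else h l

/-- Membership in a label class. [cite: AmbainisIraidsSmotrovs2013, §3 (proof of Thm. 1)] -/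
@[simp] theorem mem_labelSet {h : Hist k} {r : Fin k} {i : Fin (2 * k)} : i ∈ labelSet h r ↔ h i = some r := by
  simp [labelSet]

/-- Membership in the free set. [cite: AmbainisIraidsSmotrovs2013, §3 (proof of Thm. 1)] -/
@[simp] theorem mem_free {h : Hist k} {i : Fin (2 * k)} : i ∈ free h ↔ h i = none := by
  simp [free]

/-- The empty history is the valid `0`-history. [cite: AmbainisIraidsSmotrovs2013, §3 (proof of Thm. 1)] -/
theorem valid_emptyHist : Valid 0 (emptyHist k) :=
  ⟨fun i r h => by simp [emptyHist] at h, fun r hr => absurd hr (Nat.not_lt_zero _)⟩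

/-- Everything is free at the start (`2k` active variables). [cite: AmbainisIraidsSmotrovs2013, §3 (proof of Thm. 1)] -/
theorem free_emptyHist : free (emptyHist k) = univ := by
  ext i; simp [emptyHist]

/-- The label classes and the free set partition the indices: `#free + 2t = 2k`. [cite: AmbainisIraidsSmotrovs2013, §3 (proof of Thm. 1)] -/
theorem card_free_add (t : ℕ) {h : Hist k} (hv : Valid t h) (ht : t ≤ k) :
    (free h).card + 2 * t = 2 * k := by
  classical
  -- indices = free ⊔ ⋃_{r < t} labelSet r
  have hcover : (univ : Finset (Fin (2 * k))) =
      free h ∪ (univ.filter fun r : Fin k => r.val < t).biUnion (labelSet h) := by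
    ext i
    simp only [mem_univ, mem_union, mem_free, mem_biUnion, mem_filter, mem_labelSet, true_and, true_iff]
    cases hi : h i with
    | none => exact Or.inl rfl
    | some r => exact Or.inr ⟨r, hv.1 i r hi, rfl⟩
  have hdisj : Disjoint (free h) ((univ.filter fun r : Fin k => r.val < t).biUnion (labelSet h)) := by
    rw [Finset.disjoint_left]
    intro i hi hi'
    rw [mem_free] at hi
    obtain ⟨r, -, hr⟩ := mem_biUnion.1 hi'
    rw [mem_labelSet, hi] at hr
    exact absurd hr (by simp)
  have hpair : ((univ.filter fun r : Fin k => r.val < t).biUnion (labelSet h)).card = 2 * t := by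
    rw [Finset.card_biUnion]
    · rw [Finset.sum_congr rfl fun r hr => hv.2 r (mem_filter.1 hr).2, Finset.sum_const, smul_eq_mul,
        Fin.card_filter_val_lt, Nat.min_eq_right ht]
      omega
    · intro r _ r' _ hrr'
      rw [Function.onFun, Finset.disjoint_left]
      intro i hi hi'
      rw [mem_labelSet] at hi hi'
      rw [hi] at hi'
      exact hrr' (Option.some_injective _ hi')
  have := congrArg Finset.card hcover
  rw [Finset.card_union_of_disjoint hdisj, Finset.card_univ, Fintype.card_fin, hpair] at this
  omega

/-! ### Adding and erasing a round -/

variable {h : Hist k} {t : ℕ}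

/-- The first index of the new pair carries the round label. [cite: AmbainisIraidsSmotrovs2013, §3 (proof of Thm. 1)] -/
theorem addPair_apply_left (h : Hist k) (r : Fin k) (i j : Fin (2 * k)) : addPair h r i j i = some r := by
  simp [addPair]

/-- The second index of the new pair carries the round label. [cite: AmbainisIraidsSmotrovs2013, §3 (proof of Thm. 1)] -/
theorem addPair_apply_right (h : Hist k) (r : Fin k) (i j : Fin (2 * k)) : addPair h r i j j = some r := by
  simp [addPair]

/-- Other indices keep their labels. [cite: AmbainisIraidsSmotrovs2013, §3 (proof of Thm. 1)] -/
theorem addPair_apply_of_ne {h : Hist k} {r : Fin k} {i j l : Fin (2 * k)} (hi : l ≠ i) (hj : l ≠ j) :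
    addPair h r i j l = h l := by
  simp [addPair, hi, hj]

/-- The pair is unordered. [cite: AmbainisIraidsSmotrovs2013, §3 (proof of Thm. 1)] -/
theorem addPair_comm (h : Hist k) (r : Fin k) (i j : Fin (2 * k)) : addPair h r i j = addPair h r j i := by
  funext l; simp only [addPair, or_comm]

/-- In a valid `t`-history no index carries the label `t`. [cite: AmbainisIraidsSmotrovs2013, §3 (proof of Thm. 1)] -/
theorem ne_some_of_valid (hv : Valid t h) {r : Fin k} (hr : t ≤ r.val) (l : Fin (2 * k)) : h l ≠ some r :=
  fun hl => absurd (hv.1 l r hl) (by omega)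

/-- The free set after adding a pair. [cite: AmbainisIraidsSmotrovs2013, §3] -/
theorem free_addPair (h : Hist k) (r : Fin k) (i j : Fin (2 * k)) :
    free (addPair h r i j) = ((free h).erase i).erase j := by
  ext l
  simp only [mem_free, Finset.mem_erase, addPair]
  by_cases hli : l = i
  · subst hli; simp
  · by_cases hlj : l = j
    · subst hlj; simp
    · simp [hli, hlj]

/-- Its cardinality drops by two. [cite: AmbainisIraidsSmotrovs2013, §3] -/
theorem card_free_addPair (r : Fin k) {i j : Fin (2 * k)}
    (hi : i ∈ free h) (hj : j ∈ free h) (hij : i ≠ j) :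
    (free (addPair h r i j)).card + 2 = (free h).card := by
  rw [free_addPair, Finset.card_erase_of_mem (Finset.mem_erase.2 ⟨hij.symm, hj⟩),
    Finset.card_erase_of_mem hi]
  have : 2 ≤ (free h).card := by
    have h1 : {i, j} ⊆ free h := by
      intro l hl; rcases Finset.mem_insert.1 hl with rfl | hl; exact hi; rw [Finset.mem_singleton.1 hl]; exact hj
    have := Finset.card_le_card h1
    rwa [Finset.card_pair hij] at this
  omega

/-- The label classes of the extended history. [cite: AmbainisIraidsSmotrovs2013, §3] -/
theorem labelSet_addPair_self (hv : Valid t h) {r : Fin k} (hr : t ≤ r.val) (i j : Fin (2 * k)) :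
    labelSet (addPair h r i j) r = {i, j} := by
  ext l
  simp only [mem_labelSet, addPair, Finset.mem_insert, Finset.mem_singleton]
  constructor
  · intro hl
    by_contra hne
    push Not at hne
    rw [if_neg (not_or.2 ⟨hne.1, hne.2⟩)] at hl
    exact ne_some_of_valid hv hr l hl
  · intro hl; rw [if_pos hl]

/-- Earlier label classes are unchanged by a new pair. [cite: AmbainisIraidsSmotrovs2013, §3 (proof of Thm. 1)] -/
theorem labelSet_addPair_of_ne {r r' : Fin k} (hrr : r' ≠ r) {i j : Fin (2 * k)}
    (hi : h i = none) (hj : h j = none) : labelSet (addPair h r i j) r' = labelSet h r' := by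
  ext l
  simp only [mem_labelSet, addPair]
  by_cases hl : l = i ∨ l = j
  · rw [if_pos hl]
    rcases hl with rfl | rfl
    · rw [hi]; simp [hrr.symm]
    · rw [hj]; simp [hrr.symm]
  · rw [if_neg hl]

/-- Adding a pair of distinct free indices in round `t` to a valid `t`-history gives a valid
`(t+1)`-history. [cite: AmbainisIraidsSmotrovs2013, §3] -/
theorem valid_addPair (hv : Valid t h) {r : Fin k} (hr : r.val = t) {i j : Fin (2 * k)}
    (hi : i ∈ free h) (hj : j ∈ free h) (hij : i ≠ j) : Valid (t + 1) (addPair h r i j) := by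
  rw [mem_free] at hi hj
  refine ⟨fun l r' hl => ?_, fun r' hr' => ?_⟩
  · simp only [addPair] at hl
    split_ifs at hl with hc
    · cases hl; omega
    · have := hv.1 l r' hl; omega
  · by_cases hrr : r' = r
    · subst hrr; rw [labelSet_addPair_self hv (by omega), Finset.card_pair hij]
    · rw [labelSet_addPair_of_ne hrr hi hj]
      exact hv.2 r' (by have : r'.val ≠ r.val := fun hh => hrr (Fin.ext hh); omega)

/-- Erasing the round just added recovers the history. [cite: AmbainisIraidsSmotrovs2013, §3] -/
theorem eraseRound_addPair (hv : Valid t h) {r : Fin k} (hr : t ≤ r.val) {i j : Fin (2 * k)}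
    (hi : h i = none) (hj : h j = none) : eraseRound (addPair h r i j) r = h := by
  funext l
  simp only [eraseRound, addPair]
  by_cases hl : l = i ∨ l = j
  · rw [if_pos hl, if_pos rfl]; rcases hl with rfl | rfl; exact hi.symm; exact hj.symm
  · rw [if_neg hl, if_neg (ne_some_of_valid hv hr l)]

/-- Conversely, a valid `(t+1)`-history is its erased `t`-history plus its round-`t` pair.
[cite: AmbainisIraidsSmotrovs2013, §3] -/
theorem valid_eraseRound (hv : Valid (t + 1) h) (r : Fin k) (hr : r.val = t) : Valid t (eraseRound h r) := by
  refine ⟨fun l r' hl => ?_, fun r' hr' => ?_⟩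
  · simp only [eraseRound] at hl
    split_ifs at hl with hc
    have h1 := hv.1 l r' hl
    have h2 : r' ≠ r := fun hh => hc (hh ▸ hl)
    have h3 : r'.val ≠ t := fun hh => h2 (Fin.ext (by rw [hh, hr]))
    omega
  · have : labelSet (eraseRound h r) r' = labelSet h r' := by
      ext l
      simp only [mem_labelSet, eraseRound]
      split_ifs with hc
      · constructor
        · intro hh; exact absurd hh (by simp)
        · intro hh; rw [hc] at hh; cases hh; omega
      · rfl
    rw [this]; exact hv.2 r' (by omega)

/-- Re-adding the erased round-`t` pair recovers the history. [cite: AmbainisIraidsSmotrovs2013, §3 (proof of Thm. 1)] -/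
theorem addPair_eraseRound (r : Fin k) {i j : Fin (2 * k)}
    (hl : labelSet h r = {i, j}) : addPair (eraseRound h r) r i j = h := by
  funext l
  simp only [addPair, eraseRound]
  have hmem : ∀ l, h l = some r ↔ l = i ∨ l = j := fun l => by
    rw [← mem_labelSet, hl]; simp
  by_cases hc : l = i ∨ l = j
  · rw [if_pos hc]; exact ((hmem l).2 hc).symm
  · rw [if_neg hc, if_neg (fun hh => hc ((hmem l).1 hh))]

/-- The round-`t` pair of a valid `(t+1)`-history: two distinct indices. [cite: AmbainisIraidsSmotrovs2013, §3] -/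
theorem exists_pair_of_valid (hv : Valid (t + 1) h) (r : Fin k) (hr : r.val = t) :
    ∃ a b : Fin (2 * k), a ≠ b ∧ labelSet h r = {a, b} :=
  Finset.card_eq_two.1 (hv.2 r (by omega))

/-- **Characterisation of the predecessors**: `addPair h' r i j = h` with `h'` valid at `t`, `i ≠ j` free in
`h'`, happens exactly for `h' = eraseRound h r` and `{i, j}` = the round-`t` pair of `h`.
[cite: AmbainisIraidsSmotrovs2013, §3] -/
theorem addPair_eq_iff {h' : Hist k} (hv' : Valid t h') (r : Fin k) (hr : r.val = t)
    {i j : Fin (2 * k)} (hi : h' i = none) (hj : h' j = none) (h : Hist k) :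
    addPair h' r i j = h ↔ h' = eraseRound h r ∧ labelSet h r = {i, j} := by
  constructor
  · rintro rfl
    exact ⟨(eraseRound_addPair hv' (by omega) hi hj).symm, labelSet_addPair_self hv' (by omega) i j⟩
  · rintro ⟨rfl, hl⟩
    exact addPair_eraseRound r hl

/-! ### Partition of the indices by a valid history -/

/-- Summing over all indices = over the free ones plus over each removed pair. [cite: AmbainisIraidsSmotrovs2013, §3 (proof of Thm. 1)] -/
theorem sum_eq_sum_free_add (hv : Valid t h) (f : Fin (2 * k) → ℕ) :
    ∑ i, f i = ∑ i ∈ free h, f i + ∑ r ∈ univ.filter (fun r : Fin k => r.val < t), ∑ i ∈ labelSet h r, f i := by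
  classical
  have hcover : (univ : Finset (Fin (2 * k))) =
      free h ∪ (univ.filter fun r : Fin k => r.val < t).biUnion (labelSet h) := by
    ext i
    simp only [mem_univ, mem_union, mem_free, mem_biUnion, mem_filter, mem_labelSet, true_and, true_iff]
    cases hi : h i with
    | none => exact Or.inl rfl
    | some r => exact Or.inr ⟨r, hv.1 i r hi, rfl⟩
  have hdisj : Disjoint (free h) ((univ.filter fun r : Fin k => r.val < t).biUnion (labelSet h)) := by
    rw [Finset.disjoint_left]
    intro i hi hi'
    rw [mem_free] at hi
    obtain ⟨r, -, hr⟩ := mem_biUnion.1 hi'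
    rw [mem_labelSet, hi] at hr
    exact absurd hr (by simp)
  have hpd : ((univ.filter fun r : Fin k => r.val < t) : Set (Fin k)).PairwiseDisjoint (labelSet h) := by
    intro r _ r' _ hrr'
    rw [Function.onFun, Finset.disjoint_left]
    intro i hi hi'
    rw [mem_labelSet] at hi hi'
    rw [hi] at hi'
    exact hrr' (Option.some_injective _ hi')
  conv_lhs => rw [show (∑ i, f i) = ∑ i ∈ (univ : Finset (Fin (2 * k))), f i from rfl, hcover]
  rw [Finset.sum_union hdisj, Finset.sum_biUnion hpd]

/-! ### The signs and the amplitudes -/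

/-- `x̂_i = (−1)^{x_i}`. [cite: AmbainisIraidsSmotrovs2013, §3] -/
def xhat (x : Fin (2 * k) → Bool) (i : Fin (2 * k)) : ℂ := if x i = true then -1 else 1

/-- The orientation sign of the pair state `|{i,j}⟩` seen from `i`: `+` if `i < j`, `−` if `i > j`.
[cite: AmbainisIraidsSmotrovs2013, §3 (the `U₂` formula)] -/
def pairSign (i j : Fin (2 * k)) : ℂ := if i < j then 1 else -1

/-- The orientation sign is antisymmetric (`+|i,j⟩` for `j > i`, `−|j,i⟩` for `j < i`). [cite: AmbainisIraidsSmotrovs2013, §3 (proof of Thm. 1)] -/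
theorem pairSign_antisymm {i j : Fin (2 * k)} (hij : i ≠ j) : pairSign j i = -pairSign i j := by
  unfold pairSign
  rcases lt_trichotomy i j with h | h | h
  · rw [if_pos h, if_neg (not_lt.2 h.le)]
  · exact absurd h hij
  · rw [if_neg (not_lt.2 h.le), if_pos h, neg_neg]

/-- The orientation sign is `±1`. [cite: AmbainisIraidsSmotrovs2013, §3 (proof of Thm. 1)] -/
theorem pairSign_mul_self (i j : Fin (2 * k)) : pairSign i j * pairSign i j = 1 := by
  unfold pairSign; split_ifs <;> norm_num

/-- Summing over the ordered pairs of distinct elements of `s` is summing over `a ∈ s`, `b ∈ s ∖ {a}`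
(the bookkeeping of the printed `Σ_{j>i} … − Σ_{j<i} …`). [cite: AmbainisIraidsSmotrovs2013, §3 (proof of Thm. 1)] -/
theorem sum_offDiag_eq_sum_erase {α M : Type*} [DecidableEq α] [AddCommMonoid M] (s : Finset α)
    (f : α × α → M) : ∑ p ∈ s.offDiag, f p = ∑ a ∈ s, ∑ b ∈ s.erase a, f (a, b) := by
  have h : s.offDiag = (s ×ˢ s).filter (fun p : α × α => p.1 ≠ p.2) := by
    ext p; simp [Finset.mem_offDiag, and_assoc]
  rw [h, Finset.sum_filter, Finset.sum_product]
  refine Finset.sum_congr rfl fun a _ => ?_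
  rw [← Finset.sum_filter]
  exact Finset.sum_congr (by ext b; simp [Finset.mem_erase, and_comm, eq_comm]) fun _ _ => rfl

/-- The interference factor of round `r`: `Σ_{(i,j) ordered, i ≠ j in the round-r pair} x̂_i · sign(i,j)`
(`= ±(x̂_a − x̂_b)` for the pair `{a,b}`). [cite: AmbainisIraidsSmotrovs2013, §3 ("the resulting quantum state")] -/
def pairSum (x : Fin (2 * k) → Bool) (h : Hist k) (r : Fin k) : ℂ :=
  ∑ p ∈ (labelSet h r).offDiag, xhat x p.1 * pairSign p.1 p.2

/-- For a two-element class `{a, b}` the factor is `sign(a,b)·(x̂_a − x̂_b)`. [cite: AmbainisIraidsSmotrovs2013, §3] -/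
theorem pairSum_pair {x : Fin (2 * k) → Bool} {r : Fin k} {a b : Fin (2 * k)} (hab : a ≠ b)
    (hl : labelSet h r = {a, b}) : pairSum x h r = pairSign a b * (xhat x a - xhat x b) := by
  unfold pairSum
  rw [sum_offDiag_eq_sum_erase, hl, Finset.sum_pair hab, Finset.erase_insert (by simp [hab]),
    Finset.sum_singleton, Finset.pair_comm, Finset.erase_insert (by simp [Ne.symm hab]),
    Finset.sum_singleton, pairSign_antisymm hab]
  ring

/-- A round factor vanishes iff its pair is not mixed. [cite: AmbainisIraidsSmotrovs2013, §3] -/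
theorem pairSum_ne_zero_iff {x : Fin (2 * k) → Bool} {r : Fin k} {a b : Fin (2 * k)} (hab : a ≠ b)
    (hl : labelSet h r = {a, b}) : pairSum x h r ≠ 0 ↔ x a ≠ x b := by
  rw [pairSum_pair hab hl]
  have hs : pairSign a b ≠ 0 := by unfold pairSign; split_ifs <;> norm_num
  simp only [ne_eq, mul_eq_zero, hs, false_or, sub_eq_zero, xhat]
  cases x a <;> cases x b <;> norm_num

/-- **The amplitude of a history** after `t` rounds: `β(h·(a,b)) = β(h) · (x̂_a − x̂_b)·sign / (2 m_h)`.
[cite: AmbainisIraidsSmotrovs2013, §3 ("the resulting quantum state")] -/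
def beta (x : Fin (2 * k) → Bool) : ℕ → Hist k → ℂ
  | 0, _ => 1
  | t + 1, h => if ht : t < k then
      beta x t (eraseRound h ⟨t, ht⟩) * pairSum x h ⟨t, ht⟩ / (2 * ((k : ℂ) - t)) else 0

/-- Number of ones of `x` inside a set of indices. [folklore] -/
def onesIn (x : Fin (2 * k) → Bool) (s : Finset (Fin (2 * k))) : ℕ := (s.filter fun i => x i = true).card

omit k in
/-- The number of ones as a sum of indicators. [cite: AmbainisIraidsSmotrovs2013, §3 (proof of Thm. 1)] -/
theorem onesIn_eq_sum {k : ℕ} (x : Fin (2 * k) → Bool) (s : Finset (Fin (2 * k))) :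
    onesIn x s = ∑ i ∈ s, (if x i = true then 1 else 0) := by
  unfold onesIn; rw [Finset.card_filter]

/-- A mixed pair contains exactly one `1`. [cite: AmbainisIraidsSmotrovs2013, §3 (proof of Thm. 1)] -/
theorem onesIn_pair_of_ne {x : Fin (2 * k) → Bool} {a b : Fin (2 * k)} (hab : a ≠ b) (hx : x a ≠ x b) :
    onesIn x {a, b} = 1 := by
  rw [onesIn_eq_sum, Finset.sum_pair hab]
  cases ha : x a <;> cases hb : x b <;> simp_all

/-- A surviving history has every removed pair mixed. [cite: AmbainisIraidsSmotrovs2013, §3 ("then `x_i ≠ x_j`")] -/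
theorem onesIn_labelSet_of_beta_ne_zero {x : Fin (2 * k) → Bool} :
    ∀ (t : ℕ) (h : Hist k), Valid t h → beta x t h ≠ 0 → ∀ r : Fin k, r.val < t → onesIn x (labelSet h r) = 1
  | 0, _, _, _, r, hr => absurd hr (Nat.not_lt_zero _)
  | t + 1, h, hv, hb, r, hr => by
    simp only [beta] at hb
    split_ifs at hb with ht
    · have hb1 : beta x t (eraseRound h ⟨t, ht⟩) ≠ 0 := by
        intro h0; apply hb; rw [h0]; simp
      have hb2 : pairSum x h ⟨t, ht⟩ ≠ 0 := by
        intro h0; apply hb; rw [h0]; simp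
      obtain ⟨a, b, hab, hl⟩ := exists_pair_of_valid hv ⟨t, ht⟩ rfl
      by_cases hrt : r.val = t
      · have : r = ⟨t, ht⟩ := Fin.ext hrt
        subst this
        rw [hl]
        exact onesIn_pair_of_ne hab ((pairSum_ne_zero_iff hab hl).1 hb2)
      · have hv' := valid_eraseRound hv ⟨t, ht⟩ rfl
        have ih := onesIn_labelSet_of_beta_ne_zero t _ hv' hb1 r (by omega)
        have hls : labelSet (eraseRound h ⟨t, ht⟩) r = labelSet h r := by
          ext l; simp only [mem_labelSet, eraseRound]
          split_ifs with hc
          · constructor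
            · intro e; exact absurd e (by simp)
            · intro e; rw [hc] at e; cases e; exact absurd rfl hrt
          · rfl
        rwa [hls] at ih
    · exact absurd hb (by simp)

/-- **The weight of `x` from a surviving history**: `|x| = (ones among the free indices) + t`.
[cite: AmbainisIraidsSmotrovs2013, §3] -/
theorem hw_eq_onesIn_free_add {x : Fin (2 * k) → Bool} (hv : Valid t h) (hb : beta x t h ≠ 0) (ht : t ≤ k) :
    Grover.hw x = onesIn x (free h) + t := by
  have h1 : Grover.hw x = onesIn x univ := rfl
  rw [h1, onesIn_eq_sum, sum_eq_sum_free_add hv, ← onesIn_eq_sum]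
  congr 1
  rw [Finset.sum_congr rfl fun r hr => by
    rw [← onesIn_eq_sum, onesIn_labelSet_of_beta_ne_zero t h hv hb r (mem_filter.1 hr).2],
    Finset.sum_const, smul_eq_mul, mul_one, Fin.card_filter_val_lt, Nat.min_eq_right ht]

/-- A full surviving history forces `|x| = k`. [cite: AmbainisIraidsSmotrovs2013, §3] -/
theorem hw_eq_of_beta_ne_zero {x : Fin (2 * k) → Bool} (hv : Valid k h) (hb : beta x k h ≠ 0) :
    Grover.hw x = k := by
  have h0 : (free h).card = 0 := by have := card_free_add k hv le_rfl; omega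
  have h1 := hw_eq_onesIn_free_add hv hb le_rfl
  rw [Finset.card_eq_zero.1 h0] at h1
  simpa [onesIn] using h1

/-- On a surviving history of a balanced input the free indices are balanced: `Σ_{free} x̂_i = 0`.
[cite: AmbainisIraidsSmotrovs2013, §3 ("if we get `|0⟩`, then EXACT(x) = 0")] -/
theorem sum_xhat_free_eq_zero {x : Fin (2 * k) → Bool} (hv : Valid t h) (hb : beta x t h ≠ 0) (ht : t ≤ k)
    (hx : Grover.hw x = k) : ∑ i ∈ free h, xhat x i = 0 := by
  have hones : onesIn x (free h) + t = k := by rw [← hw_eq_onesIn_free_add hv hb ht, hx]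
  have hcard : (free h).card + 2 * t = 2 * k := card_free_add t hv ht
  have hz : ((free h).filter fun i => ¬ x i = true).card = onesIn x (free h) := by
    have := Finset.card_filter_add_card_filter_not (s := free h) (fun i => x i = true)
    unfold onesIn at *; omega
  rw [← Finset.sum_filter_add_sum_filter_not (free h) (fun i => x i = true)]
  have h1 : ∑ i ∈ (free h).filter (fun i => x i = true), xhat x i =
      ∑ i ∈ (free h).filter (fun i => x i = true), (-1 : ℂ) :=
    Finset.sum_congr rfl fun i hi => by simp [xhat, (mem_filter.1 hi).2]
  have h2 : ∑ i ∈ (free h).filter (fun i => ¬ x i = true), xhat x i =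
      ∑ i ∈ (free h).filter (fun i => ¬ x i = true), (1 : ℂ) :=
    Finset.sum_congr rfl fun i hi => by simp [xhat, (mem_filter.1 hi).2]
  rw [h1, h2, Finset.sum_const, Finset.sum_const, hz, nsmul_eq_mul, nsmul_eq_mul]
  unfold onesIn; ring

/-! ### Levels, predecessors and the re-indexing of the pair sum -/

/-- A history has at most one valid level. [cite: AmbainisIraidsSmotrovs2013, §3 (proof of Thm. 1)] -/
theorem valid_level_eq (hv : Valid t h) {t' : ℕ} (hv' : Valid t' h) (ht : t ≤ k) (ht' : t' ≤ k) : t = t' := by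
  have h1 := card_free_add t hv ht
  have h2 := card_free_add t' hv' ht'
  omega

/-- A valid `t`-history is not a round-`≥ t` extension. [folklore] -/
private theorem ne_addPair_of_valid {h' : Hist k} (hv' : Valid t h') {r : Fin k} (hr : t ≤ r.val) (g : Hist k)
    (i j : Fin (2 * k)) : h' ≠ addPair g r i j := fun he =>
  ne_some_of_valid hv' hr i (by rw [he, addPair_apply_left])

/-- A two-element set containing `a ≠ b` is `{a, b}`. [folklore] -/
private theorem eq_pair_of_card_two {s : Finset (Fin (2 * k))} (hs : s.card = 2) {a b : Fin (2 * k)} (ha : a ∈ s)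
    (hb : b ∈ s) (hab : a ≠ b) : s = {a, b} := by
  symm
  apply Finset.eq_of_subset_of_card_le
  · intro l hl
    rcases Finset.mem_insert.1 hl with rfl | hl
    · exact ha
    · rw [Finset.mem_singleton.1 hl]; exact hb
  · rw [hs, Finset.card_pair hab]

/-- The round-`t` class of a valid `(t+1)`-history is any ordered pair of distinct members of it. [folklore] -/
private theorem labelSet_eq_pair (hv : Valid (t + 1) h) (r : Fin k) (hr : r.val = t) {p : Fin (2 * k) × Fin (2 * k)}
    (hp : p ∈ (labelSet h r).offDiag) : labelSet h r = {p.1, p.2} := by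
  rw [Finset.mem_offDiag] at hp
  exact eq_pair_of_card_two (hv.2 r (by omega)) hp.1 hp.2.1 hp.2.2

/-- Erasing a round frees its pair. [cite: AmbainisIraidsSmotrovs2013, §3 (proof of Thm. 1)] -/
theorem eraseRound_apply_of_mem_labelSet {r : Fin k} {l : Fin (2 * k)} (hl : l ∈ labelSet h r) :
    eraseRound h r l = none := by
  rw [mem_labelSet] at hl
  simp [eraseRound, hl]

/-- `addPair h r i j = addPair h r i' j'` iff `{i, j} = {i', j'}` (no label `r` in `h`). [folklore] -/
private theorem addPair_eq_addPair_iff (hv : Valid t h) {r : Fin k} (hr : t ≤ r.val) {i j i' j' : Fin (2 * k)} :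
    addPair h r i j = addPair h r i' j' ↔ ({i, j} : Finset (Fin (2 * k))) = {i', j'} := by
  constructor
  · intro he
    rw [← labelSet_addPair_self hv hr i j, he, labelSet_addPair_self hv hr]
  · intro he
    funext l
    have hl : (l = i ∨ l = j) ↔ (l = i' ∨ l = j') := by
      have h1 := congrArg (l ∈ ·) he
      simpa using h1
    simp only [addPair, hl]

open Classical in
/-- The valid `t`-histories, as a `Finset`. [cite: AmbainisIraidsSmotrovs2013, §3] -/
def validSet (k t : ℕ) : Finset (Hist k) := univ.filter (Valid t)

/-- Membership in the valid set. [cite: AmbainisIraidsSmotrovs2013, §3 (proof of Thm. 1)] -/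
theorem mem_validSet : h ∈ validSet k t ↔ Valid t h := by
  classical
  simp only [validSet, Finset.mem_filter, Finset.mem_univ, true_and]

/-- **Re-indexing the branching**: summing over valid `t`-histories `g` and ordered pairs of distinct free
indices `(i, j)` of `g` a quantity attached to the child `g·(t ↦ {i,j})` is summing over valid
`(t+1)`-histories `g'` and the two orderings of their round-`t` pair.
[cite: AmbainisIraidsSmotrovs2013, §3 (the recursion of the proof of Thm. 1)] -/
theorem sum_validSet_offDiag_free (ht : t < k) {M : Type*} [AddCommMonoid M]
    (Φ : Hist k → Fin (2 * k) × Fin (2 * k) → M) :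
    ∑ g ∈ validSet k t, ∑ p ∈ (free g).offDiag, Φ (addPair g ⟨t, ht⟩ p.1 p.2) p =
      ∑ g' ∈ validSet k (t + 1), ∑ p ∈ (labelSet g' ⟨t, ht⟩).offDiag, Φ g' p := by
  set r : Fin k := ⟨t, ht⟩ with hr_def
  have hL : (∑ g ∈ validSet k t, ∑ p ∈ (free g).offDiag, Φ (addPair g r p.1 p.2) p) =
      ∑ x ∈ (validSet k t).sigma (fun g => (free g).offDiag), Φ (addPair x.1 r x.2.1 x.2.2) x.2 :=
    (Finset.sum_sigma _ _ (fun x : (Σ _ : Hist k, Fin (2 * k) × Fin (2 * k)) =>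
      Φ (addPair x.1 r x.2.1 x.2.2) x.2)).symm
  have hR : (∑ g' ∈ validSet k (t + 1), ∑ p ∈ (labelSet g' r).offDiag, Φ g' p) =
      ∑ y ∈ (validSet k (t + 1)).sigma (fun g' => (labelSet g' r).offDiag), Φ y.1 y.2 :=
    (Finset.sum_sigma _ _ (fun y : (Σ _ : Hist k, Fin (2 * k) × Fin (2 * k)) => Φ y.1 y.2)).symm
  rw [hL, hR]
  refine Finset.sum_bij' (fun x _ => ⟨addPair x.1 r x.2.1 x.2.2, x.2⟩) (fun y _ => ⟨eraseRound y.1 r, y.2⟩)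
    ?_ ?_ ?_ ?_ ?_
  · rintro ⟨g, p⟩ hx
    rw [Finset.mem_sigma, mem_validSet, Finset.mem_offDiag] at hx
    obtain ⟨hv, hp1, hp2, hne⟩ := hx
    rw [Finset.mem_sigma, mem_validSet, Finset.mem_offDiag, mem_labelSet, mem_labelSet]
    exact ⟨valid_addPair hv rfl hp1 hp2 hne, addPair_apply_left _ _ _ _, addPair_apply_right _ _ _ _, hne⟩
  · rintro ⟨g', p⟩ hy
    rw [Finset.mem_sigma, mem_validSet] at hy
    obtain ⟨hv', hp⟩ := hy
    have hp' := Finset.mem_offDiag.1 hp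
    rw [Finset.mem_sigma, mem_validSet, Finset.mem_offDiag, mem_free, mem_free]
    exact ⟨valid_eraseRound hv' r rfl, eraseRound_apply_of_mem_labelSet hp'.1,
      eraseRound_apply_of_mem_labelSet hp'.2.1, hp'.2.2⟩
  · rintro ⟨g, p⟩ hx
    rw [Finset.mem_sigma, mem_validSet, Finset.mem_offDiag, mem_free, mem_free] at hx
    obtain ⟨hv, hp1, hp2, -⟩ := hx
    simp only [eraseRound_addPair hv (r := r) le_rfl hp1 hp2]
  · rintro ⟨g', p⟩ hy
    rw [Finset.mem_sigma, mem_validSet] at hy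
    obtain ⟨hv', hp⟩ := hy
    simp only [addPair_eraseRound r (labelSet_eq_pair hv' r rfl hp)]
  · rintro ⟨g, p⟩ _
    rfl

/-! ### The state space: index × target × (status × history) -/

/-- The workspace: a status bit (`true` = the branch measured `|0⟩`, parked) and a history.
[cite: AmbainisIraidsSmotrovs2013, §3 (deferred measurements of the recursive algorithm)] -/
abbrev WS (k : ℕ) := Bool × Hist k

/-- The computational basis `Fin (2k) × Bool × WS k` of the algorithm. [cite: BealsEtAl2001, §2] -/
abbrev S (k : ℕ) := Fin (2 * k) × Bool × WS k

section Vectors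

/-- The normalisation `1/√(#free g)`. [cite: AmbainisIraidsSmotrovs2013, §3] -/
def cw (g : Hist k) : ℝ := 1 / √((free g).card : ℝ)

/-- `cw(g)² · #free g = 1`. [cite: AmbainisIraidsSmotrovs2013, §3 (proof of Thm. 1)] -/
theorem cw_sq_mul_card {g : Hist k} (hg : free g ≠ ∅) : cw g ^ 2 * (free g).card = 1 := by
  have hc : (0 : ℝ) < (free g).card := by
    exact_mod_cast (Finset.nonempty_iff_ne_empty.2 hg).card_pos
  rw [cw, div_pow, one_pow, Real.sq_sqrt hc.le]
  field_simp

/-- Slices: a sum over the basis of a quantity living on one `(target, workspace)` slice.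
[folklore] -/
private theorem sum_slice {M : Type*} [AddCommMonoid M] (b : Bool) (ws : WS k) (G : Fin (2 * k) → M) :
    ∑ s : S k, (if s.2.1 = b ∧ s.2.2 = ws then G s.1 else 0) = ∑ l, G l := by
  rw [Fintype.sum_prod_type]
  refine Finset.sum_congr rfl fun l _ => ?_
  have hq : ∀ q : Bool × WS k, (q.1 = b ∧ q.2 = ws) ↔ q = (b, ws) := fun q => by
    constructor
    · rintro ⟨h1, h2⟩; exact Prod.ext h1 h2
    · rintro rfl; exact ⟨rfl, rfl⟩
  simp_rw [hq]
  rw [Finset.sum_ite_eq']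
  simp

/-- The real orientation sign. [cite: AmbainisIraidsSmotrovs2013, §3] -/
def pairSignR (i j : Fin (2 * k)) : ℝ := if i < j then 1 else -1

/-- The complex orientation sign is the real one. [cite: AmbainisIraidsSmotrovs2013, §3 (proof of Thm. 1)] -/
theorem pairSign_eq_cast (i j : Fin (2 * k)) : pairSign i j = (pairSignR i j : ℂ) := by
  unfold pairSign pairSignR; split_ifs <;> simp

/-- The real orientation sign is `±1`. [cite: AmbainisIraidsSmotrovs2013, §3 (proof of Thm. 1)] -/
theorem pairSignR_mul_self (i j : Fin (2 * k)) : pairSignR i j * pairSignR i j = 1 := by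
  unfold pairSignR; split_ifs <;> norm_num

/-- The real orientation sign is antisymmetric. [cite: AmbainisIraidsSmotrovs2013, §3 (proof of Thm. 1)] -/
theorem pairSignR_antisymm {i j : Fin (2 * k)} (hij : i ≠ j) : pairSignR j i = -pairSignR i j := by
  unfold pairSignR
  rcases lt_trichotomy i j with h | h | h
  · rw [if_pos h, if_neg (not_lt.2 h.le)]
  · exact absurd h hij
  · rw [if_neg (not_lt.2 h.le), if_pos h, neg_neg]

/-- `⟨Σ_j σ_j ψ_j, Σ_j' σ'_j' ψ'_j'⟩` expanded. [folklore] -/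
private theorem sum_smul_dot_sum_smul {ι : Type*} (A B : Finset ι) (σ τ : ι → ℝ) (u v : ι → S k → ℝ) :
    (∑ j ∈ A, σ j • u j) ⬝ᵥ (∑ j' ∈ B, τ j' • v j') = ∑ j ∈ A, ∑ j' ∈ B, σ j * τ j' * (u j ⬝ᵥ v j') := by
  rw [sum_dotProduct]
  refine Finset.sum_congr rfl fun j _ => ?_
  rw [dotProduct_sum]
  refine Finset.sum_congr rfl fun j' _ => ?_
  rw [smul_dotProduct, dotProduct_smul, smul_eq_mul, smul_eq_mul]
  ring

/-- `{i, j} = {i, j'}` with `j, j' ≠ i` forces `j = j'`. [folklore] -/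
private theorem pair_eq_pair_left {i j j' : Fin (2 * k)} (hj' : j' ≠ i)
    (he : ({i, j} : Finset (Fin (2 * k))) = {i, j'}) : j = j' := by
  have : j' ∈ ({i, j} : Finset (Fin (2 * k))) := by rw [he]; simp
  rcases Finset.mem_insert.1 this with h1 | h1
  · exact absurd h1 hj'
  · exact (Finset.mem_singleton.1 h1).symm

/-- `{i, j} = {i', j'}` with `i ≠ i'` forces `j = i'` and `j' = i`. [folklore] -/
private theorem pair_eq_pair_cross {i j i' j' : Fin (2 * k)} (hii : i ≠ i')
    (he : ({i, j} : Finset (Fin (2 * k))) = {i', j'}) : j = i' ∧ j' = i := by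
  have h1 : i ∈ ({i', j'} : Finset (Fin (2 * k))) := by rw [← he]; simp
  have h2 : i' ∈ ({i, j} : Finset (Fin (2 * k))) := by rw [he]; simp
  simp only [Finset.mem_insert, Finset.mem_singleton] at h1 h2
  rcases h2 with h2 | h2
  · exact absurd h2.symm hii
  rcases h1 with h1 | h1
  · exact absurd h1 hii
  exact ⟨h2.symm, h1.symm⟩

open Classical in
/-- The live basis states before round `r`'s gate: status live, a valid `r`-history, a free index.
[cite: AmbainisIraidsSmotrovs2013, §3] -/
def Dset (k : ℕ) (r : Fin k) : Finset (S k) :=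
  univ.filter fun s => s.2.2.1 = false ∧ Valid r.val s.2.2.2 ∧ s.2.2.2 s.1 = none

/-- Membership in the live set of round `r`. [cite: AmbainisIraidsSmotrovs2013, §3 (proof of Thm. 1)] -/
theorem mem_Dset {r : Fin k} {s : S k} :
    s ∈ Dset k r ↔ s.2.2.1 = false ∧ Valid r.val s.2.2.2 ∧ s.2.2.2 s.1 = none := by
  classical
  simp only [Dset, Finset.mem_filter, Finset.mem_univ, true_and]

variable [NeZero k]

/-- The parking index `0`. [folklore] -/
def i0 (k : ℕ) [NeZero k] : Fin (2 * k) := ⟨0, by have := NeZero.pos k; omega⟩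

/-- The amplitude profile of the next starting state on history `g`: uniform over the free indices
(the printed `(1/√(2k')) Σ_i |i⟩` of the recursive call), or the basis state `|i0⟩` when nothing is free
(the call `EXACT⁰₀`, which accepts). [cite: AmbainisIraidsSmotrovs2013, §3 (proof of Thm. 1)] -/
def campl (g : Hist k) (l : Fin (2 * k)) : ℝ :=
  if free g = ∅ then (if l = i0 k then 1 else 0) else (if g l = none then cw g else 0)

/-- The profile is a unit vector. [cite: AmbainisIraidsSmotrovs2013, §3] -/
theorem sum_campl_sq (g : Hist k) : ∑ l, campl g l ^ 2 = 1 := by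
  by_cases h0 : free g = ∅
  · have hc : ∀ l, campl g l = if l = i0 k then 1 else 0 := fun l => by simp [campl, h0]
    simp_rw [hc, ite_pow, one_pow, zero_pow two_ne_zero, Finset.sum_ite_eq', Finset.mem_univ, if_true]
  · have hc : ∀ l, campl g l = if g l = none then cw g else 0 := fun l => by simp [campl, h0]
    simp_rw [hc, ite_pow, zero_pow two_ne_zero]
    rw [← Finset.sum_filter]
    change ∑ _l ∈ free g, cw g ^ 2 = 1
    rw [Finset.sum_const, nsmul_eq_mul, mul_comm]
    exact cw_sq_mul_card h0

/-- The (real) `b`-slice state `ψ_{g,b} = Σ_l campl g l · |l, b, live, g⟩`. [cite: AmbainisIraidsSmotrovs2013, §3] -/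
def psiR (g : Hist k) (b : Bool) : S k → ℝ := fun s =>
  if s.2.1 = b ∧ s.2.2 = (false, g) then campl g s.1 else 0

/-- `ψ_{g,b}` vanishes off its slice. [cite: AmbainisIraidsSmotrovs2013, §3 (proof of Thm. 1)] -/
theorem psiR_of_ne {g : Hist k} {b : Bool} {s : S k} (hs : ¬ (s.2.1 = b ∧ s.2.2 = (false, g))) :
    psiR g b s = 0 := by
  simp only [psiR, if_neg hs]

/-- `ψ_{g,b}` vanishes on parked states. [cite: AmbainisIraidsSmotrovs2013, §3 (proof of Thm. 1)] -/
theorem psiR_of_status {g : Hist k} {b : Bool} {s : S k} (hs : s.2.2.1 = true) : psiR g b s = 0 :=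
  psiR_of_ne fun h => by have := congrArg Prod.fst h.2; simp [hs] at this

/-- **The slice states are orthonormal.** [cite: AmbainisIraidsSmotrovs2013, §3] -/
theorem psiR_dot (g g' : Hist k) (b b' : Bool) :
    psiR g b ⬝ᵥ psiR g' b' = if g = g' ∧ b = b' then 1 else 0 := by
  unfold dotProduct
  by_cases hh : g = g' ∧ b = b'
  · obtain ⟨rfl, rfl⟩ := hh
    rw [if_pos ⟨rfl, rfl⟩]
    have : ∀ s : S k, psiR g b s * psiR g b s =
        if s.2.1 = b ∧ s.2.2 = (false, g) then campl g s.1 ^ 2 else 0 := fun s => by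
      unfold psiR; split_ifs <;> ring
    simp_rw [this]
    exact (sum_slice b (false, g) fun l => campl g l ^ 2).trans (sum_campl_sq g)
  · rw [if_neg hh]
    refine Finset.sum_eq_zero fun s _ => ?_
    by_cases h1 : s.2.1 = b ∧ s.2.2 = (false, g)
    · have h2 : ¬ (s.2.1 = b' ∧ s.2.2 = (false, g')) := fun h2 => hh ⟨by
        have := h1.2.symm.trans h2.2; simpa using this, h1.1.symm.trans h2.1⟩
      rw [psiR_of_ne h2, mul_zero]
    · rw [psiR_of_ne h1, zero_mul]

/-- The parked basis state `|i0, b, parked, h⟩` of the branch that measured `|0⟩` in the round that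
produced `h`. [cite: AmbainisIraidsSmotrovs2013, §3 ("If we get `|0⟩`, then EXACT(x) = 0 and we output `0`")] -/
def deadIdx (b : Bool) (h : Hist k) : S k := (i0 k, b, (true, h))

/-- **The round family** (real form): for a live basis state `d = |i, b, live, h⟩`,
`w(d) = (1/√(2m)) · ( |i0, b, parked, h⟩ + Σ_{j free, j ≠ i} sign(i,j) · ψ_{h·{i,j}, b} )`, `2m = #free h` —
the printed `U_{2k}|i⟩ = (1/√(2k))|0⟩ + … Σ_{j>i}|i,j⟩ − … Σ_{j<i}|j,i⟩` followed by the deferred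
measurement and the preparation of the next call's starting state. [cite: AmbainisIraidsSmotrovs2013, §3 (proof of Thm. 1)] -/
def wR (r : Fin k) (d : S k) : S k → ℝ :=
  cw d.2.2.2 • (Pi.single (deadIdx d.2.1 d.2.2.2) 1 +
    ∑ j ∈ (free d.2.2.2).erase d.1, pairSignR d.1 j • psiR (addPair d.2.2.2 r d.1 j) d.2.1)

/-- The round family as complex vectors (the columns of the round gate). [cite: AmbainisIraidsSmotrovs2013, §3] -/
def wvec (r : Fin k) (d : S k) : S k → ℂ := fun s => (wR r d s : ℂ)

/-! ### Inner products of the round family -/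

/-- The pair part of `w(d)` vanishes on parked states. [folklore] -/
private theorem pairPart_apply_of_status (r : Fin k) (i : Fin (2 * k)) (b : Bool) (h : Hist k) {s : S k}
    (hs : s.2.2.1 = true) :
    (∑ j ∈ (free h).erase i, pairSignR i j • psiR (addPair h r i j) b) s = 0 := by
  rw [Finset.sum_apply]
  exact Finset.sum_eq_zero fun j _ => by rw [Pi.smul_apply, psiR_of_status hs, smul_zero]

/-- **Gram matrix of the round family**: `⟨w(d), w(d')⟩ = cw·cw'·([b=b' ∧ h=h'] + Σ_{j,j'} σσ'[children equal ∧ b=b'])`.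
[cite: AmbainisIraidsSmotrovs2013, §3 ("one can verify that this inner product is the same")] -/
theorem wR_dot (r : Fin k) (i i' : Fin (2 * k)) (b b' : Bool) (h h' : Hist k) :
    wR r (i, b, (false, h)) ⬝ᵥ wR r (i', b', (false, h')) =
      cw h * cw h' * ((if b = b' ∧ h = h' then 1 else 0) +
        ∑ j ∈ (free h).erase i, ∑ j' ∈ (free h').erase i', pairSignR i j * pairSignR i' j' *
          (if addPair h r i j = addPair h' r i' j' ∧ b = b' then 1 else 0)) := by
  simp only [wR]
  rw [smul_dotProduct, dotProduct_smul, smul_eq_mul, smul_eq_mul, add_dotProduct, dotProduct_add,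
    dotProduct_add, sum_smul_dot_sum_smul]
  have e1 : (Pi.single (deadIdx b h) (1 : ℝ) : S k → ℝ) ⬝ᵥ Pi.single (deadIdx b' h') 1 =
      if b = b' ∧ h = h' then 1 else 0 := by
    rw [single_dotProduct, one_mul, Pi.single_apply, deadIdx, deadIdx]
    congr 1
    simp [Prod.ext_iff]
  have e2 : (Pi.single (deadIdx b h) (1 : ℝ) : S k → ℝ) ⬝ᵥ
      (∑ j' ∈ (free h').erase i', pairSignR i' j' • psiR (addPair h' r i' j') b') = 0 := by
    rw [single_dotProduct, one_mul, pairPart_apply_of_status r i' b' h' (s := deadIdx b h) rfl]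
  have e3 : (∑ j ∈ (free h).erase i, pairSignR i j • psiR (addPair h r i j) b) ⬝ᵥ
      Pi.single (deadIdx b' h') (1 : ℝ) = 0 := by
    rw [dotProduct_single, mul_one, pairPart_apply_of_status r i b h (s := deadIdx b' h') rfl]
  rw [e1, e2, e3]
  simp only [psiR_dot]
  ring

/-- **Unit norm**: `⟨w(d), w(d)⟩ = (1 + (2m − 1))/(2m) = 1`. [cite: AmbainisIraidsSmotrovs2013, §3 (proof of Thm. 1)] -/
theorem wR_dot_self (r : Fin k) {i : Fin (2 * k)} {b : Bool} {h : Hist k} (hv : Valid r.val h) (hi : h i = none) :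
    wR r (i, b, (false, h)) ⬝ᵥ wR r (i, b, (false, h)) = 1 := by
  rw [wR_dot, if_pos ⟨rfl, rfl⟩]
  have hF : i ∈ free h := mem_free.2 hi
  have hsum : ∑ j ∈ (free h).erase i, ∑ j' ∈ (free h).erase i, pairSignR i j * pairSignR i j' *
      (if addPair h r i j = addPair h r i j' ∧ b = b then (1 : ℝ) else 0) = (((free h).erase i).card : ℝ) := by
    rw [Finset.sum_congr rfl fun j hj => ?_, Finset.sum_const, nsmul_eq_mul, mul_one]
    rw [Finset.sum_eq_single j]
    · rw [if_pos ⟨rfl, rfl⟩, mul_one, pairSignR_mul_self]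
    · intro j' hj' hne
      have hj'i : j' ≠ i := (Finset.mem_erase.1 hj').1
      rw [if_neg, mul_zero]
      rintro ⟨he, -⟩
      rw [addPair_eq_addPair_iff hv le_rfl] at he
      exact hne (pair_eq_pair_left hj'i he).symm
    · intro hj'; exact absurd hj hj'
  rw [hsum, Finset.card_erase_of_mem hF]
  have hne : free h ≠ ∅ := Finset.ne_empty_of_mem hF
  have hpos : 1 ≤ (free h).card := Finset.card_pos.2 ⟨i, hF⟩
  rw [Nat.cast_sub hpos, Nat.cast_one, add_sub_cancel, ← sq]
  exact cw_sq_mul_card hne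

/-- **Orthogonality**: distinct live states go to orthogonal vectors (the printed inner-product check:
`(1/(2k)) − (1/(2k)) = 0` for `i ≠ i'`). [cite: AmbainisIraidsSmotrovs2013, §3 (proof of Thm. 1)] -/
theorem wR_dot_of_ne (r : Fin k) {i i' : Fin (2 * k)} {b b' : Bool} {h h' : Hist k} (hv : Valid r.val h)
    (hv' : Valid r.val h') (hi : h i = none) (hi' : h' i' = none)
    (hne : ((i, b, (false, h)) : S k) ≠ (i', b', (false, h'))) :
    wR r (i, b, (false, h)) ⬝ᵥ wR r (i', b', (false, h')) = 0 := by
  rw [wR_dot]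
  by_cases hbh : b = b' ∧ h = h'
  · obtain ⟨rfl, rfl⟩ := hbh
    have hii : i ≠ i' := fun hii => hne (by rw [hii])
    rw [if_pos ⟨rfl, rfl⟩]
    have hF' : i' ∈ (free h).erase i := Finset.mem_erase.2 ⟨Ne.symm hii, mem_free.2 hi'⟩
    have hsum : ∑ j ∈ (free h).erase i, ∑ j' ∈ (free h).erase i', pairSignR i j * pairSignR i' j' *
        (if addPair h r i j = addPair h r i' j' ∧ b = b then (1 : ℝ) else 0) = -1 := by
      rw [Finset.sum_eq_single i']
      · rw [Finset.sum_eq_single i]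
        · rw [if_pos ⟨by rw [addPair_comm], rfl⟩, mul_one, pairSignR_antisymm hii]
          have := pairSignR_mul_self i i'
          linear_combination (-1 : ℝ) * this
        · intro j' _ hj'i
          rw [if_neg, mul_zero]
          rintro ⟨he, -⟩
          rw [addPair_eq_addPair_iff hv le_rfl] at he
          exact hj'i (pair_eq_pair_cross hii he).2
        · intro hh; exact absurd (Finset.mem_erase.2 ⟨hii, mem_free.2 hi⟩) hh
      · intro j _ hji'
        refine Finset.sum_eq_zero fun j' _ => ?_
        rw [if_neg, mul_zero]
        rintro ⟨he, -⟩
        rw [addPair_eq_addPair_iff hv le_rfl] at he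
        exact hji' (pair_eq_pair_cross hii he).1
      · intro hh; exact absurd hF' hh
    rw [hsum]; ring
  · rw [if_neg hbh]
    have hsum : ∑ j ∈ (free h).erase i, ∑ j' ∈ (free h').erase i', pairSignR i j * pairSignR i' j' *
        (if addPair h r i j = addPair h' r i' j' ∧ b = b' then (1 : ℝ) else 0) = 0 := by
      refine Finset.sum_eq_zero fun j hj => Finset.sum_eq_zero fun j' hj' => ?_
      rw [if_neg, mul_zero]
      rintro ⟨he, hb⟩
      apply hbh
      refine ⟨hb, ?_⟩
      have hj : h j = none := mem_free.1 (Finset.mem_erase.1 hj).2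
      have hj'f : h' j' = none := mem_free.1 (Finset.mem_erase.1 hj').2
      rw [← eraseRound_addPair hv le_rfl hi hj, he, eraseRound_addPair hv' le_rfl hi' hj'f]
    rw [hsum]; ring

/-- `w(d)` vanishes on every live state with a valid `r`-history (its live part sits on `(r+1)`-histories).
[cite: AmbainisIraidsSmotrovs2013, §3] -/
theorem wR_apply_of_valid (r : Fin k) (d : S k) {s : S k} (hs : s.2.2.1 = false) (hv : Valid r.val s.2.2.2) :
    wR r d s = 0 := by
  obtain ⟨l, b', st, g⟩ := s
  simp only at hs; subst hs
  simp only [wR, Pi.smul_apply, Pi.add_apply, Finset.sum_apply, smul_eq_mul]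
  rw [Pi.single_eq_of_ne (by simp [deadIdx]), zero_add]
  rw [Finset.sum_eq_zero, mul_zero]
  intro j _
  rw [psiR_of_ne, mul_zero]
  rintro ⟨-, hh⟩
  exact ne_addPair_of_valid hv le_rfl _ _ _ (Prod.ext_iff.1 hh).2

/-- `star` fixes the (real) round vectors. [cite: AmbainisIraidsSmotrovs2013, §3 (proof of Thm. 1)] -/
@[simp] theorem star_wvec (r : Fin k) (d : S k) : star (wvec r d) = wvec r d := by
  funext s; simp [wvec]

/-- Inner products of the complex round vectors are the real ones. [cite: AmbainisIraidsSmotrovs2013, §3 (proof of Thm. 1)] -/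
theorem wvec_dot (r : Fin k) (d d' : S k) : star (wvec r d) ⬝ᵥ wvec r d' = ((wR r d ⬝ᵥ wR r d' : ℝ) : ℂ) := by
  rw [star_wvec]
  simp only [dotProduct, wvec]
  push_cast
  rfl

/-- **The round family is admissible** (orthonormal on the live states, image orthogonal to them), so
`IsoGate.invoGate` turns it into a unitary round gate. [cite: AmbainisIraidsSmotrovs2013, §3 (proof of Thm. 1)] -/
theorem wvec_isAdmissible (r : Fin k) : IsoGate.IsAdmissible (Dset k r) (wvec r) := by
  refine ⟨fun d hd d' hd' => ?_, fun d hd d' hd' => ?_⟩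
  · obtain ⟨i, b, st, h⟩ := d
    obtain ⟨i', b', st', h'⟩ := d'
    rw [mem_Dset] at hd hd'
    obtain ⟨rfl, hv, hi⟩ := hd
    obtain ⟨rfl, hv', hi'⟩ := hd'
    rw [wvec_dot]
    by_cases he : ((i, b, (false, h)) : S k) = (i', b', (false, h'))
    · rw [if_pos he, ← he, wR_dot_self r hv hi]; simp
    · rw [if_neg he, wR_dot_of_ne r hv hv' hi hi' he]; simp
  · rw [mem_Dset] at hd'
    simp only [wvec, wR_apply_of_valid r d hd'.1 hd'.2.1, Complex.ofReal_zero]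

/-! ### Complex forms used by the program -/

/-- The slice state as a complex vector. [cite: AmbainisIraidsSmotrovs2013, §3] -/
def psiC (g : Hist k) (b : Bool) : S k → ℂ := fun s => (psiR g b s : ℂ)

omit [NeZero k] in
/-- Real and complex basis vectors agree entrywise. [folklore] -/
private theorem single_cast (a s : S k) :
    (((Pi.single a (1 : ℝ) : S k → ℝ) s : ℝ) : ℂ) = (Pi.single a (1 : ℂ) : S k → ℂ) s := by
  by_cases h : s = a
  · subst h; simp
  · simp [Pi.single_eq_of_ne h]

/-- **The columns of the round gate, expanded**: `w(|i,b,·,h⟩) = cw(h) · (|i0,b,parked,h⟩ +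
Σ_{j free, j ≠ i} sign(i,j) ψ_{h·{i,j},b})`. [cite: AmbainisIraidsSmotrovs2013, §3 (proof of Thm. 1)] -/
theorem wvec_eq (r : Fin k) (i : Fin (2 * k)) (b st : Bool) (h : Hist k) :
    wvec r (i, b, (st, h)) = (cw h : ℂ) • ((Pi.single (deadIdx b h) (1 : ℂ) : S k → ℂ) +
      ∑ j ∈ (free h).erase i, pairSign i j • psiC (addPair h r i j) b) := by
  funext s
  simp only [wvec, wR, Pi.smul_apply, Pi.add_apply, Finset.sum_apply, smul_eq_mul, psiC,
    pairSign_eq_cast]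
  push_cast
  rw [single_cast]

/-- After a query the live slice state carries the phases `x̂_l`. [cite: AmbainisIraidsSmotrovs2013, §3] -/
def psiX (x : Fin (2 * k) → Bool) (g : Hist k) (b : Bool) : S k → ℂ := fun s => xhat x s.1 * psiC g b s

/-- The phased slice state in the computational basis: `Σ_{l free} x̂_l cw(g) |l, b, live, g⟩`.
[cite: AmbainisIraidsSmotrovs2013, §3] -/
theorem psiX_eq_sum {g : Hist k} (hg : free g ≠ ∅) (x : Fin (2 * k) → Bool) (b : Bool) :
    psiX x g b = ∑ l ∈ free g, (xhat x l * (cw g : ℂ)) • (Pi.single (l, b, (false, g)) (1 : ℂ) : S k → ℂ) := by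
  funext s
  rw [Finset.sum_apply]
  simp only [psiX, psiC, psiR, campl, if_neg hg, Pi.smul_apply, smul_eq_mul]
  by_cases hs : s.2.1 = b ∧ s.2.2 = (false, g)
  · have hs' : s = (s.1, b, (false, g)) := Prod.ext rfl (Prod.ext hs.1 hs.2)
    rw [if_pos hs]
    by_cases hl : g s.1 = none
    · rw [if_pos hl, Finset.sum_eq_single_of_mem s.1 (mem_free.2 hl)]
      · rw [← hs', Pi.single_eq_same, mul_one]
      · intro l _ hl'
        rw [Pi.single_eq_of_ne (fun he => hl' (congrArg Prod.fst he).symm), mul_zero]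
    · rw [if_neg hl]
      push_cast
      rw [mul_zero, eq_comm]
      refine Finset.sum_eq_zero fun l hl' => ?_
      rw [Pi.single_eq_of_ne, mul_zero]
      intro he
      exact hl (by rw [he]; exact mem_free.1 hl')
  · rw [if_neg hs]
    push_cast
    rw [mul_zero, eq_comm]
    refine Finset.sum_eq_zero fun l _ => ?_
    rw [Pi.single_eq_of_ne, mul_zero]
    intro he
    exact hs (by rw [he]; exact ⟨rfl, rfl⟩)

/-- `ψ_{g,b}` lives on the slice `(b, live, g)`. [cite: AmbainisIraidsSmotrovs2013, §3 (proof of Thm. 1)] -/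
theorem psiC_ne_zero {g : Hist k} {b : Bool} {s : S k} (hs : psiC g b s ≠ 0) :
    s.2.1 = b ∧ s.2.2 = (false, g) := by
  by_contra hc
  exact hs (by rw [psiC, psiR_of_ne hc, Complex.ofReal_zero])

end Vectors

end Literature.Computability.QuantumComplexity.ExactHalf

end
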